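import Mathlib
import Literature.Barriers.ValiantsHypothesis.AlgebraicNaturalProofs
import Literature.Computability.AlgebraicComplexity.ArithCircuitProofs
import Summits.ValiantsHypothesis.ValiantsHypothesis.Theorems.BarrierLeverSingleSizeEquationsReductions
import HarnessLib

/-!
# Crux `BarrierLever.DefinableEquations` (stmt-ValiantsHypothesis-8745), line `registered` —
# stub `rungOne_of_exists_degreeOf_le_two`: the first rung (`b ≤ 1`) by the cube-monomial equation

The crux asks, for ONE level `a` and EVERY size exponent `b`, for a nonzero boolean sum
`E = boolSum H` (`q ≤ N^a` boolean variables, `L(H) ≤ N^a`, `deg H ≤ N^a`, `N = C(2n,n)`) in the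
`N` coefficient variables `c_m` (`m` an exponent vector of degree `≤ n`) vanishing at `coeff(f)`
for every `f ∈ SmallCircuits ℂ n b` (degree `≤ n`, circuit size `≤ n^b`).

This file proves its FIRST RUNG `b ≤ 1` (circuits of size `≤ n`) CONDITIONALLY on the structure
statement taken as the hypothesis: every `f` of complexity `≤ n` (`n ≥ 1`) has a variable `x_j` of
individual degree `≤ 2`, hence `coeff_{x_j^3}(f) = 0`.  The equation is then the monomial
`E = ∏_{j < n} c_{x_j^3}` in the coefficient variables (`x_j^3 = Finsupp.single j 3` has degree
`3 ≤ n` for `n ≥ 3`), and `H = rename Sum.inl E` with `q = 0` boolean variables: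

* `boolSum H = E` (`boolSum_rename_inl`), and `E ≠ 0` (a product of variables over the domain
  `MvPolynomial _ ℂ`);
* `L(H) ≤ L(E) ≤ ∑_j L(c_{x_j^3}) + n = n ≤ C(2n,n)` (`complexity_rename_le`,
  `complexity_finset_prod_le`, `complexity_X`; `n ≤ 2n = C(2n,1) ≤ C(2n,n)`);
* `deg H ≤ deg E ≤ n ≤ C(2n,n)`;
* for `f ∈ SmallCircuits ℂ n b`, `b ≤ 1`: `L(f) ≤ n^b ≤ n`, so some `x_j` has `degreeOf j f ≤ 2`,
  `coeff (single j 3) f = 0`, and `E(coeff f) = ∏_j coeff (single j 3) f = 0`.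

Elementary; no new definitions, no named facts.
-/

-- single-conjunct layout: Sub = Summit, duplicated namespace component intended
set_option linter.dupNamespace false

namespace Summit.ValiantsHypothesis.ValiantsHypothesis.Theorems.BarrierLeverDefinableEquations

open MvPolynomial
open Literature.Computability.AlgebraicComplexity Literature.Barriers.ValiantsHypothesis
open Summit.ValiantsHypothesis.ValiantsHypothesis.Theorems.SingleSizeEquations

/-- `n ≤ C(2n, n)`: `n ≤ 2n = C(2n, 1) ≤ C(2n, n)`, the middle binomial coefficient being the
largest. [folklore] -/
theorem le_choose_two_mul_self (n : ℕ) : n ≤ Nat.choose (2 * n) n := by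
  have h := Nat.choose_le_middle 1 (2 * n)
  rw [Nat.choose_one_right, Nat.mul_div_cancel_left n Nat.two_pos] at h
  omega

/-- The cube exponent vector `x_j^3 = Finsupp.single j 3` has degree `3 ≤ n`, so it is one of the
`N = C(2n,n)` coefficient variables `degLEMonomials n` once `3 ≤ n`. [folklore] -/
theorem single_three_mem_degLEMonomials {n : ℕ} (hn : 3 ≤ n) (j : Fin n) :
    (Finsupp.single j 3 : Fin n →₀ ℕ) ∈ degLEMonomials n := by
  show (Finsupp.single j 3 : Fin n →₀ ℕ).degree ≤ n
  rwa [Finsupp.degree_single]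

/-- A polynomial with `degreeOf j f ≤ 2` has no `x_j^3` coefficient. [folklore] -/
theorem coeff_single_three_eq_zero {n : ℕ} {f : MvPolynomial (Fin n) ℂ} {j : Fin n}
    (hj : f.degreeOf j ≤ 2) : MvPolynomial.coeff (Finsupp.single j 3) f = 0 := by
  rw [← MvPolynomial.notMem_support_iff]
  intro hm
  have h := MvPolynomial.monomial_le_degreeOf j hm
  rw [Finsupp.single_eq_same] at h
  omega

/-- **First rung of `DefinableEquations` (`b ≤ 1`), conditional on the structure statement.**
If every `f : MvPolynomial (Fin n) ℂ` of complexity `≤ n` (`n ≥ 1`) has a variable of individual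
degree `≤ 2`, then for all `n ≥ 3` and `b ≤ 1` the cube monomial `E = ∏_j c_{x_j^3}` (as the
empty boolean sum of `H = rename Sum.inl E`, `q = 0`) is a nonzero level-`1` equation
(`L(H), deg H ≤ n ≤ C(2n,n)`) vanishing at `coeff(f)` for every `f ∈ SmallCircuits ℂ n b`.
[folklore] -/
theorem rungOne_of_exists_degreeOf_le_two :
    (∀ n : ℕ, 1 ≤ n → ∀ f : MvPolynomial (Fin n) ℂ,
      Literature.Computability.AlgebraicComplexity.complexity f ≤ n → ∃ j : Fin n,
        f.degreeOf j ≤ 2) → ∃ n₀ : ℕ, ∀ n ≥ n₀, ∀ b ≤ 1, ∃ q : ℕ, q ≤ (Nat.choose (2 * n) n) ^ 1 ∧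
      ∃ H : MvPolynomial (↥(Literature.Barriers.ValiantsHypothesis.degLEMonomials n) ⊕ Fin q) ℂ,
        Literature.Computability.AlgebraicComplexity.complexity H ≤ (Nat.choose (2 * n) n) ^ 1 ∧
          H.totalDegree ≤ (Nat.choose (2 * n) n) ^ 1 ∧
            Literature.Computability.AlgebraicComplexity.boolSum H ≠ 0 ∧
              ∀ f ∈ Literature.Barriers.ValiantsHypothesis.SmallCircuits ℂ n b, MvPolynomial.eval
                (Literature.Barriers.ValiantsHypothesis.coeffVector
                  (Literature.Barriers.ValiantsHypothesis.degLEMonomials n) f)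
                (Literature.Computability.AlgebraicComplexity.boolSum H) = 0 := by
  intro hstruct
  refine ⟨3, fun n hn b hb => ?_⟩
  have hN : n ≤ (Nat.choose (2 * n) n) ^ 1 := (le_choose_two_mul_self n).trans (pow_one _).ge
  -- the cube coefficient variables `c_{x_j^3}`
  obtain ⟨cube, hcube⟩ : ∃ cube : Fin n → degLEMonomials n,
      ∀ j, (cube j : Fin n →₀ ℕ) = Finsupp.single j 3 :=
    ⟨fun j => ⟨Finsupp.single j 3, single_three_mem_degLEMonomials hn j⟩, fun _ => rfl⟩
  refine ⟨0, Nat.zero_le _, MvPolynomial.rename Sum.inl (∏ j : Fin n, X (cube j)), ?_, ?_, ?_, ?_⟩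
  · -- `L(rename inl E) ≤ L(E) ≤ 0 + n ≤ N`
    refine (complexity_rename_le_holds' _ _).trans ((complexity_finset_prod_le _ _).trans ?_)
    rw [Finset.sum_eq_zero fun j _ => complexity_X_holds (cube j), zero_add, Finset.card_univ,
      Fintype.card_fin]
    exact hN
  · -- `deg (rename inl E) ≤ deg E ≤ n ≤ N`
    refine (MvPolynomial.totalDegree_rename_le _ _).trans
      ((MvPolynomial.totalDegree_finsetProd _ _).trans ?_)
    simp only [MvPolynomial.totalDegree_X, Finset.sum_const, Finset.card_univ, Fintype.card_fin,
      smul_eq_mul, mul_one]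
    exact hN
  · -- `boolSum (rename inl E) = E ≠ 0`
    rw [boolSum_rename_inl]
    exact Finset.prod_ne_zero_iff.mpr fun j _ => MvPolynomial.X_ne_zero (cube j)
  · -- vanishing on `SmallCircuits ℂ n b`, `b ≤ 1`
    intro f hf
    rw [boolSum_rename_inl, map_prod]
    have hLf : complexity f ≤ n :=
      hf.2.trans ((Nat.pow_le_pow_right (by omega) hb).trans (pow_one n).le)
    obtain ⟨j, hj⟩ := hstruct n (by omega) f hLf
    refine Finset.prod_eq_zero (Finset.mem_univ j) ?_
    rw [MvPolynomial.eval_X, coeffVector_apply, hcube]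
    exact coeff_single_three_eq_zero hj

end Summit.ValiantsHypothesis.ValiantsHypothesis.Theorems.BarrierLeverDefinableEquations
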